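import Mathlib.Analysis.Convex.Gauge
import Summits.QuantumFields.YangMills.Theorems.BalabanUVNodesPortS1Sect4WardRows

/-!
# PORT helper (PT-C lineage, helper mode) — THE MINKOWSKI GAUGE OF PRINT's (4.4)∕(1.14) DOMAIN AT THE RECORD's TWO-BLOCK NAMES, COMPUTED:
# `gauge (recordDom44J F Mc k K X α₂)` against the four scaled norm families; `cutTo`-transparency; α₂-scaling; block read-backs;
# definiteness and boundedness on the cut space

Cell `ym-nodeO-ideate` ∕ programme cell `ym-balaban-port`, porter seat `ymgap-nodeO-port-PTC-1` (gen 2, HELPER MODE per director-ym R615 and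
port-lead N-10: PT-C `stmt-QuantumFields-27932` is CLOSED·proved by `…K0PortChart44DAtRecord.portRowE118U2_sig`, not re-touched here);
`--kind proof --supports stmt-QuantumFields-27931 --as helper` (count-neutral).  [I] = [Balaban1987RG1], [15] = [Balaban1985Variational].

WHY THIS FILE.  The response rows of the signed PT-B text 27931⁷ (`B12FormatPlus.Response9D` (R1ᴰ)∕(R4ᴰ): [15] Prop. 9 (190) p.308 read as [I] p.282)
and the Π-holomorphy join of the PT-H path (CRIT-1 RULING (Φ2), nodeO STATUS 2026-08-30T23:48Z: «X's cut coordinate space normed by `α₂ · gauge (D n X)` …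
convex, balanced, absorbing, von Neumann bounded on the cut space — one porter lemma») are BOTH measured by the Minkowski gauge (Mathlib `gauge`) of DEF-1's
named domain `recordDom44J F Mc k K X α₂` = print's (4.4) p.281 «max{|A|, |∇^ξA|, |Δ^ξA|} < α₂» in the chart's units plus (1.14) «|𝐉| < γ₀».  Computed here once:
* §1 ★ `recordDom44J_smul` (`s • D(α₂) = D(s·α₂)`), `gauge_recordDom44J_smul`, ★ `gauge_recordDom44J_eq_inv_mul` (`gauge D(α₂) = α₂⁻¹·gauge D(1)`).
* §2 `recordDom44J_mem_nhds_zero`, `absorbent_recordDom44J`, `gauge_recordDom44J_add_le` ∕ `_smul_eq` (a SEMINORM), ★ `mem_recordDom44J_iff_gauge_lt_one`.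
* §3 ★★ `gauge_recordDom44J_le_iff` — for `0 < α₂`, `0 ≤ t`: `gauge D w ≤ t` IFF the four families hold with `≤ t·α₂ξ`, `≤ t·α₂ξ²`, `≤ t·α₂ξ³`, `≤ t·α₂`
  (`ξ = (F.P K).eta (k+1)`); ★ `gauge_recordDom44J_le_of_forall` (the direction the (R1ᴰ)∕(R4ᴰ) transport uses).
* §4 read-backs `norm_chartMatU_le_gauge ∕ norm_sub_chartMatU_le_gauge ∕ norm_laplace_chartMatU_le_gauge ∕ norm_chartMatJc_le_gauge ∕ norm_apply_le_gauge`,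
  ★ `norm_cutTo_le_gauge` (`‖cutTo (recordCXJ X) w‖ ≤ α₂·gauge`), ★ `cutTo_eq_zero_of_gauge_eq_zero` (DEFINITE on the cut space),
  ★ `cutTo_image_recordDom44J_subset_ball` ∕ `isVonNBounded_cutTo_image_recordDom44J` (BOUNDED) — the (Φ2) instance's clauses.
* §5 ★ `cutTo_mem_recordDom44J_iff`, ★★ `gauge_recordDom44J_cutTo` (`gauge D (cutTo (recordCXJ X) u) = gauge D u`: `Response9D`'s `cutTo` is transparent).
CONSUMED BY NAME: DEF-1's names + lemma file 2 (`convex_balanced_isOpen_recordDom44J`, `zero_mem_recordDom44J`, `chartMatULM ∕ chartMatJcLM`), porter PTA-2's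
`sl2Coord_chartMatU ∕ sl2Coord_chartMatJc`, typer-1's `B12FormatPlus.cutTo`, Mathlib's `gauge` API.

HONEST FRAMING.  Convex-analysis bookkeeping about a NAMED SET; nothing of Bałaban's estimates ((4.5), (190), (1.18), §5) is asserted, ported or
discharged; 27932 CLOSED (not by this file), 27930⁷ ∕ 27931⁷ signed-OPEN, 26648 unsigned; K0⁷ `Record13SepCoPHInhabited` NOT closed; NODE O 0∕1;
COUNT 8∕28 · K 1∕4 UNMOVED; finite `𝕋⁴_{L^K}` at fixed ε — NOT continuum ∕ ℝ⁴ ∕ OS; **the Yang–Mills mass gap (Clay) is NOT proved by any of this.**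
No `def`, `instance`, `notation`, `sorry`; axioms `{propext, Classical.choice, Quot.sound}`.
-/

noncomputable section

open scoped BigOperators Matrix.Norms.L2Operator Topology Pointwise

namespace Summit.QuantumFields.YangMills.Theorems.PortU2

open Literature.MathematicalPhysics.QuantumFieldTheory.Balaban1983to89
open Literature.MathematicalPhysics.QuantumFieldTheory.Balaban1983to89.Node00
open Literature.MathematicalPhysics.QuantumFieldTheory.Balaban1983to89.T4Continuum (T4Family)
open Summit.QuantumFields.YangMills.Theorems.K0RecordFormatNames
open Summit.QuantumFields.YangMills.Theorems.BalabanUVNodesPortS1 (sl2Coord_chartMatU sl2Coord_chartMatJc)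
open B12FormatPlus (cutTo cutTo_apply)

variable (F : T4Family)

/-! ## §0  Small tools: entries versus the operator norm, the 𝔰𝔩₂-coordinates versus the operator norm, the cut index set -/

/-- Entries are bounded by the `L²`-operator norm: `‖A i j‖ ≤ ‖A‖` (test against the basis vector `e_j`). [folklore] -/
theorem norm_entry_le_opNorm (A : MatA 2) (i j : Fin 2) : ‖A i j‖ ≤ ‖A‖ := by
  set v : EuclideanSpace ℂ (Fin 2) := PiLp.single 2 j (1 : ℂ) with hv
  have hv1 : ‖v‖ = 1 := by rw [hv, PiLp.norm_single, norm_one]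
  have h1 := Matrix.l2_opNorm_mulVec A v
  rw [hv1, mul_one] at h1
  have h2 : ‖((EuclideanSpace.equiv (Fin 2) ℂ).symm (Matrix.mulVec A v.ofLp)) i‖ ≤
      ‖(EuclideanSpace.equiv (Fin 2) ℂ).symm (Matrix.mulVec A v.ofLp)‖ := PiLp.norm_apply_le _ i
  have h3 : ((EuclideanSpace.equiv (Fin 2) ℂ).symm (Matrix.mulVec A v.ofLp)) i = A i j := by
    have : v.ofLp = Pi.single j 1 := by rw [hv]; rfl
    simp [this]
  rw [h3] at h2
  exact h2.trans h1

/-- The 𝔰𝔩₂-coordinates `(A₀₁, A₁₀, (A₀₀ − A₁₁)∕2)` are bounded by the operator norm. [folklore] -/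
theorem norm_sl2Coord_le (A : MatA 2) (a : Fin 3) : ‖sl2Coord A a‖ ≤ ‖A‖ := by
  fin_cases a
  · exact norm_entry_le_opNorm A 0 1
  · exact norm_entry_le_opNorm A 1 0
  · show ‖(A 0 0 - A 1 1) / 2‖ ≤ ‖A‖
    rw [norm_div, RCLike.norm_two]
    have h0 := norm_entry_le_opNorm A 0 0
    have h1 := norm_entry_le_opNorm A 1 1
    have := norm_sub_le (A 0 0) (A 1 1)
    linarith

/-- A two-block chart index lies in the cut set `recordCXJ … X` iff its bond lies in `X`. [cite: Balaban1987RG1, (1.7) p.261 (bookkeeping)] -/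
theorem chartEquivJ_mem_recordCXJ_iff (Mc k K : ℕ) (X : (recordDomSys F Mc k K).Dom) (b : PBond (F.P K) 0) (s : Fin 3 ⊕ Fin 3) :
    chartEquivJ F K (b, s) ∈ recordCXJ F Mc k K X ↔ b ∈ domBonds F Mc k K X := by
  classical
  simp [recordCXJ]

/-- A `𝐔`-coordinate of `w` on the bond `b` is bounded by `‖chartMatU w b‖`. [cite: Balaban1987RG1, (1.9) p.261 (bookkeeping)] -/
theorem norm_apply_inl_le (K : ℕ) (w : Fin (recordChartDimJ F K) → ℂ) (b : PBond (F.P K) 0) (a : Fin 3) :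
    ‖w (chartEquivJ F K (b, Sum.inl a))‖ ≤ ‖chartMatU F K w b‖ := by
  have h := norm_sl2Coord_le (chartMatU F K w b) a
  rwa [sl2Coord_chartMatU] at h

/-- A `𝐉`-coordinate of `w` on the bond `b` is bounded by `‖chartMatJc w b‖`. [cite: Balaban1987RG1, (1.9) p.261 (bookkeeping)] -/
theorem norm_apply_inr_le (K : ℕ) (w : Fin (recordChartDimJ F K) → ℂ) (b : PBond (F.P K) 0) (a : Fin 3) :
    ‖w (chartEquivJ F K (b, Sum.inr a))‖ ≤ ‖chartMatJc F K w b‖ := by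
  have h := norm_sl2Coord_le (chartMatJc F K w b) a
  rwa [sl2Coord_chartMatJc] at h

/-! ## §1  α₂-SCALING: `s • recordDom44J … α₂ = recordDom44J … (s·α₂)` and `gauge D(α₂) = α₂⁻¹ · gauge D(1)` -/

/-- Real dilation acts on the blocks: `chartMatU (s • w) = s • chartMatU w`. [cite: Balaban1987RG1, (1.9) p.261 (bookkeeping)] -/
theorem chartMatU_real_smul (K : ℕ) (s : ℝ) (w : Fin (recordChartDimJ F K) → ℂ) (b : PBond (F.P K) 0) :
    chartMatU F K (s • w) b = (s : ℂ) • chartMatU F K w b := by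
  have h : s • w = (s : ℂ) • w := by ext i; simp
  rw [h, ← chartMatULM_apply, map_smul, chartMatULM_apply]

/-- Real dilation acts on the blocks: `chartMatJc (s • w) = s • chartMatJc w`. [cite: Balaban1987RG1, (1.9) p.261 (bookkeeping)] -/
theorem chartMatJc_real_smul (K : ℕ) (s : ℝ) (w : Fin (recordChartDimJ F K) → ℂ) (b : PBond (F.P K) 0) :
    chartMatJc F K (s • w) b = (s : ℂ) • chartMatJc F K w b := by
  have h : s • w = (s : ℂ) • w := by ext i; simp
  rw [h, ← chartMatJcLM_apply, map_smul, chartMatJcLM_apply]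

/-- ★ **α₂-SCALING OF PRINT's (4.4)∕(1.14) DOMAIN**: `s • recordDom44J … X α₂ = recordDom44J … X (s·α₂)` for `0 < s` — all four clauses are strict
norm sublevels of LINEAR maps, homogeneous of degree one. [cite: Balaban1987RG1, (4.4) p.281, (1.14) p.262] -/
theorem recordDom44J_smul (Mc k K : ℕ) (X : (recordDomSys F Mc k K).Dom) (α₂ : ℝ) {s : ℝ} (hs : 0 < s) :
    s • recordDom44J F Mc k K X α₂ = recordDom44J F Mc k K X (s * α₂) := by
  ext w
  rw [Set.mem_smul_set_iff_inv_smul_mem₀ hs.ne']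
  have hn : ∀ A : MatA 2, ‖((s⁻¹ : ℝ) : ℂ) • A‖ = s⁻¹ * ‖A‖ := fun A => by
    rw [norm_smul, Complex.norm_real, Real.norm_eq_abs, abs_of_pos (inv_pos.2 hs)]
  have hiff : ∀ (A : MatA 2) (c : ℝ), s⁻¹ * ‖A‖ < α₂ * c ↔ ‖A‖ < s * α₂ * c := fun A c => by
    rw [inv_mul_lt_iff₀ hs, mul_assoc]
  have hU : ∀ b, chartMatU F K (s⁻¹ • w) b = ((s⁻¹ : ℝ) : ℂ) • chartMatU F K w b := fun b => chartMatU_real_smul F K s⁻¹ w b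
  have hJ : ∀ b, chartMatJc F K (s⁻¹ • w) b = ((s⁻¹ : ℝ) : ℂ) • chartMatJc F K w b := fun b => chartMatJc_real_smul F K s⁻¹ w b
  simp only [recordDom44J, Set.mem_setOf_eq, hU, hJ, ← smul_sub, hn]
  have hL : ∀ b : PBond (F.P K) 0,
      (∑ μ : Fin (F.P K).d, (((s⁻¹ : ℝ) : ℂ) • chartMatU F K w ⟨b.src.shift μ, b.dir⟩ - (2 : ℂ) • (((s⁻¹ : ℝ) : ℂ) • chartMatU F K w b) +
          ((s⁻¹ : ℝ) : ℂ) • chartMatU F K w ⟨b.src.unshift μ, b.dir⟩)) =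
        ((s⁻¹ : ℝ) : ℂ) • ∑ μ : Fin (F.P K).d, (chartMatU F K w ⟨b.src.shift μ, b.dir⟩ - (2 : ℂ) • chartMatU F K w b + chartMatU F K w ⟨b.src.unshift μ, b.dir⟩) := by
    intro b
    rw [Finset.smul_sum]
    refine Finset.sum_congr rfl fun μ _ => ?_
    rw [smul_add, smul_sub, smul_comm (2 : ℂ)]
  simp only [hL, hn]
  refine ⟨fun ⟨h1, h2, h3, h4⟩ => ⟨fun b hb => ?_, fun b hb μ hμ => ?_, fun b hb hμ => ?_, fun b hb => ?_⟩,
    fun ⟨h1, h2, h3, h4⟩ => ⟨fun b hb => ?_, fun b hb μ hμ => ?_, fun b hb hμ => ?_, fun b hb => ?_⟩⟩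
  · exact (hiff _ _).1 (h1 b hb)
  · exact (hiff _ _).1 (h2 b hb μ hμ)
  · exact (hiff _ _).1 (h3 b hb hμ)
  · have := h4 b hb; rwa [inv_mul_lt_iff₀ hs] at this
  · exact (hiff _ _).2 (h1 b hb)
  · exact (hiff _ _).2 (h2 b hb μ hμ)
  · exact (hiff _ _).2 (h3 b hb hμ)
  · rw [inv_mul_lt_iff₀ hs]; exact h4 b hb

/-- The gauge scales inversely with the radius: `gauge D(s·α₂) = s⁻¹ · gauge D(α₂)` (`0 < s`). [cite: Balaban1987RG1, (4.4) p.281 (bookkeeping)] -/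
theorem gauge_recordDom44J_smul (Mc k K : ℕ) (X : (recordDomSys F Mc k K).Dom) (α₂ : ℝ) {s : ℝ} (hs : 0 < s) (w : Fin (recordChartDimJ F K) → ℂ) :
    gauge (recordDom44J F Mc k K X (s * α₂)) w = s⁻¹ * gauge (recordDom44J F Mc k K X α₂) w := by
  rw [← recordDom44J_smul F Mc k K X α₂ hs, gauge_smul_left_of_nonneg hs.le]
  rfl

/-- ★ **ONE GAUGE PER DOMAIN SHAPE**: `gauge D(α₂) w = α₂⁻¹ · gauge D(1) w` for `0 < α₂` — the radius letter factors out of every gauge row.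
[cite: Balaban1987RG1, (4.4) p.281 (bookkeeping)] -/
theorem gauge_recordDom44J_eq_inv_mul (Mc k K : ℕ) (X : (recordDomSys F Mc k K).Dom) {α₂ : ℝ} (hα : 0 < α₂) (w : Fin (recordChartDimJ F K) → ℂ) :
    gauge (recordDom44J F Mc k K X α₂) w = α₂⁻¹ * gauge (recordDom44J F Mc k K X 1) w := by
  simpa using gauge_recordDom44J_smul F Mc k K X 1 hα w

/-! ## §2  The domain is a neighbourhood of `0`: absorbent; its gauge is a seminorm; membership `↔ gauge < 1` -/

/-- `recordDom44J … X α₂ ∈ 𝓝 0` for `0 < α₂` (open and contains `0`). [cite: Balaban1987RG1, (4.4) p.281] -/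
theorem recordDom44J_mem_nhds_zero (Mc k K : ℕ) (X : (recordDomSys F Mc k K).Dom) {α₂ : ℝ} (hα : 0 < α₂) :
    recordDom44J F Mc k K X α₂ ∈ 𝓝 (0 : Fin (recordChartDimJ F K) → ℂ) :=
  (convex_balanced_isOpen_recordDom44J F Mc k K X α₂).2.2.mem_nhds (zero_mem_recordDom44J F Mc k K X hα)

/-- `recordDom44J … X α₂` is ABSORBENT for `0 < α₂` (one of the (Φ2) instance clauses). [cite: Balaban1987RG1, (4.4) p.281] -/
theorem absorbent_recordDom44J (Mc k K : ℕ) (X : (recordDomSys F Mc k K).Dom) {α₂ : ℝ} (hα : 0 < α₂) :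
    Absorbent ℝ (recordDom44J F Mc k K X α₂) :=
  absorbent_nhds_zero (recordDom44J_mem_nhds_zero F Mc k K X hα)

/-- The gauge of the domain is SUBADDITIVE (convex, absorbent). [cite: Balaban1987RG1, (4.4) p.281 (bookkeeping)] -/
theorem gauge_recordDom44J_add_le (Mc k K : ℕ) (X : (recordDomSys F Mc k K).Dom) {α₂ : ℝ} (hα : 0 < α₂) (w w' : Fin (recordChartDimJ F K) → ℂ) :
    gauge (recordDom44J F Mc k K X α₂) (w + w') ≤ gauge (recordDom44J F Mc k K X α₂) w + gauge (recordDom44J F Mc k K X α₂) w' :=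
  gauge_add_le (convex_balanced_isOpen_recordDom44J F Mc k K X α₂).1 (absorbent_recordDom44J F Mc k K X hα) w w'

/-- The gauge of the domain is ABSOLUTELY HOMOGENEOUS over `ℂ` (balanced). [cite: Balaban1987RG1, (4.4) p.281 (bookkeeping)] -/
theorem gauge_recordDom44J_smul_eq (Mc k K : ℕ) (X : (recordDomSys F Mc k K).Dom) (α₂ : ℝ) (c : ℂ) (w : Fin (recordChartDimJ F K) → ℂ) :
    gauge (recordDom44J F Mc k K X α₂) (c • w) = ‖c‖ * gauge (recordDom44J F Mc k K X α₂) w :=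
  gauge_smul (convex_balanced_isOpen_recordDom44J F Mc k K X α₂).2.1 c w

/-- ★ **MEMBERSHIP IS `gauge < 1`** (the domain is convex, open and contains `0`). [cite: Balaban1987RG1, (4.4) p.281] -/
theorem mem_recordDom44J_iff_gauge_lt_one (Mc k K : ℕ) (X : (recordDomSys F Mc k K).Dom) {α₂ : ℝ} (hα : 0 < α₂) (w : Fin (recordChartDimJ F K) → ℂ) :
    w ∈ recordDom44J F Mc k K X α₂ ↔ gauge (recordDom44J F Mc k K X α₂) w < 1 := by
  have h := convex_balanced_isOpen_recordDom44J F Mc k K X α₂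
  have := setOf_gauge_lt_one_eq_self_of_isOpen h.1 (zero_mem_recordDom44J F Mc k K X hα) h.2.2
  rw [Set.ext_iff] at this
  exact (this w).symm

/-- Membership in a dilate is `gauge < s` (`0 < s`). [cite: Balaban1987RG1, (4.4) p.281 (bookkeeping)] -/
theorem mem_smul_recordDom44J_iff_gauge_lt (Mc k K : ℕ) (X : (recordDomSys F Mc k K).Dom) {α₂ s : ℝ} (hα : 0 < α₂) (hs : 0 < s)
    (w : Fin (recordChartDimJ F K) → ℂ) :
    w ∈ recordDom44J F Mc k K X (s * α₂) ↔ gauge (recordDom44J F Mc k K X α₂) w < s := by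
  rw [mem_recordDom44J_iff_gauge_lt_one F Mc k K X (mul_pos hs hα), gauge_recordDom44J_smul F Mc k K X α₂ hs, inv_mul_lt_iff₀ hs, mul_one]

/-! ## §3  ★★ THE GAUGE COMPUTED: `gauge D w ≤ t` iff the four scaled families hold with the factor `t` -/

/-- From strict bounds at every `s > t` to the weak bound at `t` (density of `ℝ`; the scale `c` is positive). [folklore] -/
theorem le_mul_of_forall_lt_mul {N t c : ℝ} (hc : 0 < c) (h : ∀ s, t < s → N < s * c) : N ≤ t * c := by
  rw [← div_le_iff₀ hc]
  exact le_of_forall_gt_imp_ge_of_dense fun s hs => ((div_lt_iff₀ hc).2 (h s hs)).le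

/-- ★★ **THE GAUGE OF PRINT's (4.4)∕(1.14) DOMAIN, COMPUTED.**  For `0 < α₂`, `0 ≤ t` and `ξ = L^{-(k+1)}`:
`gauge (recordDom44J … X α₂) w ≤ t` IFF on the bonds of `X`: `‖W_U(b)‖ ≤ t·α₂ξ`, `‖W_U(b+e_μ) − W_U(b)‖ ≤ t·α₂ξ²` (neighbour in `X`),
`‖Σ_μ (W_U(b+e_μ) − 2W_U(b) + W_U(b−e_μ))‖ ≤ t·α₂ξ³` (full stencil in `X`), `‖W_J(b)‖ ≤ t·α₂` — i.e. the gauge IS print's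
`α₂⁻¹·max{ξ⁻¹|A|, ξ⁻²|∇A|, ξ⁻³|ΔA|, |𝐉|}` in the chart's units. [cite: Balaban1987RG1, (4.4) p.281, (1.14) p.262] -/
theorem gauge_recordDom44J_le_iff (Mc k K : ℕ) (X : (recordDomSys F Mc k K).Dom) {α₂ t : ℝ} (hα : 0 < α₂) (ht : 0 ≤ t)
    (w : Fin (recordChartDimJ F K) → ℂ) :
    gauge (recordDom44J F Mc k K X α₂) w ≤ t ↔
      (∀ b ∈ domBonds F Mc k K X, ‖chartMatU F K w b‖ ≤ t * (α₂ * (F.P K).eta (k + 1))) ∧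
      (∀ b ∈ domBonds F Mc k K X, ∀ μ : Fin (F.P K).d, (⟨b.src.shift μ, b.dir⟩ : PBond (F.P K) 0) ∈ domBonds F Mc k K X →
        ‖chartMatU F K w ⟨b.src.shift μ, b.dir⟩ - chartMatU F K w b‖ ≤ t * (α₂ * (F.P K).eta (k + 1) ^ 2)) ∧
      (∀ b ∈ domBonds F Mc k K X,
        (∀ μ : Fin (F.P K).d, (⟨b.src.shift μ, b.dir⟩ : PBond (F.P K) 0) ∈ domBonds F Mc k K X ∧
          (⟨b.src.unshift μ, b.dir⟩ : PBond (F.P K) 0) ∈ domBonds F Mc k K X) →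
        ‖∑ μ : Fin (F.P K).d, (chartMatU F K w ⟨b.src.shift μ, b.dir⟩ - (2 : ℂ) • chartMatU F K w b + chartMatU F K w ⟨b.src.unshift μ, b.dir⟩)‖ ≤
          t * (α₂ * (F.P K).eta (k + 1) ^ 3)) ∧
      (∀ b ∈ domBonds F Mc k K X, ‖chartMatJc F K w b‖ ≤ t * α₂) := by
  have hξ : 0 < (F.P K).eta (k + 1) := pow_pos (inv_pos.2 (Nat.cast_pos.2 (F.P K).L_pos)) _
  have hc1 : 0 < α₂ * (F.P K).eta (k + 1) := mul_pos hα hξ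
  have hc2 : 0 < α₂ * (F.P K).eta (k + 1) ^ 2 := mul_pos hα (pow_pos hξ 2)
  have hc3 : 0 < α₂ * (F.P K).eta (k + 1) ^ 3 := mul_pos hα (pow_pos hξ 3)
  constructor
  · intro hg
    -- at every `s > t` the vector lies in `D(s·α₂)`
    have hlt : ∀ s, t < s → w ∈ recordDom44J F Mc k K X (s * α₂) := fun s hts =>
      (mem_smul_recordDom44J_iff_gauge_lt F Mc k K X hα (ht.trans_lt hts) w).2 (hg.trans_lt hts)
    refine ⟨fun b hb => ?_, fun b hb μ hμ => ?_, fun b hb hμ => ?_, fun b hb => ?_⟩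
    · exact le_mul_of_forall_lt_mul hc1 fun s hts => by have := (hlt s hts).1 b hb; rwa [mul_assoc] at this
    · exact le_mul_of_forall_lt_mul hc2 fun s hts => by have := (hlt s hts).2.1 b hb μ hμ; rwa [mul_assoc] at this
    · exact le_mul_of_forall_lt_mul hc3 fun s hts => by have := (hlt s hts).2.2.1 b hb hμ; rwa [mul_assoc] at this
    · exact le_mul_of_forall_lt_mul hα fun s hts => (hlt s hts).2.2.2 b hb
  · rintro ⟨h1, h2, h3, h4⟩
    refine le_of_forall_gt_imp_ge_of_dense fun s hts => ?_
    have hs : 0 < s := ht.trans_lt hts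
    refine ((mem_smul_recordDom44J_iff_gauge_lt F Mc k K X hα hs w).1 ⟨fun b hb => ?_, fun b hb μ hμ => ?_, fun b hb hμ => ?_, fun b hb => ?_⟩).le
    · rw [mul_assoc]; exact (h1 b hb).trans_lt (mul_lt_mul_of_pos_right hts hc1)
    · rw [mul_assoc]; exact (h2 b hb μ hμ).trans_lt (mul_lt_mul_of_pos_right hts hc2)
    · rw [mul_assoc]; exact (h3 b hb hμ).trans_lt (mul_lt_mul_of_pos_right hts hc3)
    · exact (h4 b hb).trans_lt (mul_lt_mul_of_pos_right hts hα)

/-- ★ **SUFFICIENT DIRECTION, AS THE TRANSPORT OF (R1ᴰ)∕(R4ᴰ) USES IT**: four scaled families with the factor `t` ⟹ `gauge D w ≤ t`.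
[cite: Balaban1987RG1, (4.4)–(4.5) pp.281–282; Balaban1985Variational, (190) p.308 (the currency)] -/
theorem gauge_recordDom44J_le_of_forall (Mc k K : ℕ) (X : (recordDomSys F Mc k K).Dom) {α₂ t : ℝ} (hα : 0 < α₂) (ht : 0 ≤ t)
    (w : Fin (recordChartDimJ F K) → ℂ)
    (h1 : ∀ b ∈ domBonds F Mc k K X, ‖chartMatU F K w b‖ ≤ t * (α₂ * (F.P K).eta (k + 1)))
    (h2 : ∀ b ∈ domBonds F Mc k K X, ∀ μ : Fin (F.P K).d, (⟨b.src.shift μ, b.dir⟩ : PBond (F.P K) 0) ∈ domBonds F Mc k K X →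
      ‖chartMatU F K w ⟨b.src.shift μ, b.dir⟩ - chartMatU F K w b‖ ≤ t * (α₂ * (F.P K).eta (k + 1) ^ 2))
    (h3 : ∀ b ∈ domBonds F Mc k K X,
      (∀ μ : Fin (F.P K).d, (⟨b.src.shift μ, b.dir⟩ : PBond (F.P K) 0) ∈ domBonds F Mc k K X ∧
        (⟨b.src.unshift μ, b.dir⟩ : PBond (F.P K) 0) ∈ domBonds F Mc k K X) →
      ‖∑ μ : Fin (F.P K).d, (chartMatU F K w ⟨b.src.shift μ, b.dir⟩ - (2 : ℂ) • chartMatU F K w b + chartMatU F K w ⟨b.src.unshift μ, b.dir⟩)‖ ≤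
        t * (α₂ * (F.P K).eta (k + 1) ^ 3))
    (h4 : ∀ b ∈ domBonds F Mc k K X, ‖chartMatJc F K w b‖ ≤ t * α₂) :
    gauge (recordDom44J F Mc k K X α₂) w ≤ t :=
  (gauge_recordDom44J_le_iff F Mc k K X hα ht w).2 ⟨h1, h2, h3, h4⟩

/-! ## §4  READ-BACKS: each block, each cut coordinate and the cut vector are bounded by the gauge; DEFINITE and BOUNDED on the cut space -/

/-- `‖W_U(b)‖ ≤ gauge D w · α₂ξ` on the bonds of `X`. [cite: Balaban1987RG1, (4.4) p.281 (bookkeeping)] -/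
theorem norm_chartMatU_le_gauge (Mc k K : ℕ) (X : (recordDomSys F Mc k K).Dom) {α₂ : ℝ} (hα : 0 < α₂) (w : Fin (recordChartDimJ F K) → ℂ)
    {b : PBond (F.P K) 0} (hb : b ∈ domBonds F Mc k K X) :
    ‖chartMatU F K w b‖ ≤ gauge (recordDom44J F Mc k K X α₂) w * (α₂ * (F.P K).eta (k + 1)) :=
  ((gauge_recordDom44J_le_iff F Mc k K X hα (gauge_nonneg _) w).1 le_rfl).1 b hb

/-- `‖W_U(b+e_μ) − W_U(b)‖ ≤ gauge D w · α₂ξ²` for neighbouring bonds of `X`. [cite: Balaban1987RG1, (4.4) p.281 (bookkeeping)] -/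
theorem norm_sub_chartMatU_le_gauge (Mc k K : ℕ) (X : (recordDomSys F Mc k K).Dom) {α₂ : ℝ} (hα : 0 < α₂) (w : Fin (recordChartDimJ F K) → ℂ)
    {b : PBond (F.P K) 0} (hb : b ∈ domBonds F Mc k K X) (μ : Fin (F.P K).d)
    (hμ : (⟨b.src.shift μ, b.dir⟩ : PBond (F.P K) 0) ∈ domBonds F Mc k K X) :
    ‖chartMatU F K w ⟨b.src.shift μ, b.dir⟩ - chartMatU F K w b‖ ≤ gauge (recordDom44J F Mc k K X α₂) w * (α₂ * (F.P K).eta (k + 1) ^ 2) :=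
  ((gauge_recordDom44J_le_iff F Mc k K X hα (gauge_nonneg _) w).1 le_rfl).2.1 b hb μ hμ

/-- `‖Δ W_U(b)‖ ≤ gauge D w · α₂ξ³` where the full stencil lies in `X`. [cite: Balaban1987RG1, (4.4) p.281 (bookkeeping)] -/
theorem norm_laplace_chartMatU_le_gauge (Mc k K : ℕ) (X : (recordDomSys F Mc k K).Dom) {α₂ : ℝ} (hα : 0 < α₂) (w : Fin (recordChartDimJ F K) → ℂ)
    {b : PBond (F.P K) 0} (hb : b ∈ domBonds F Mc k K X)
    (hμ : ∀ μ : Fin (F.P K).d, (⟨b.src.shift μ, b.dir⟩ : PBond (F.P K) 0) ∈ domBonds F Mc k K X ∧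
      (⟨b.src.unshift μ, b.dir⟩ : PBond (F.P K) 0) ∈ domBonds F Mc k K X) :
    ‖∑ μ : Fin (F.P K).d, (chartMatU F K w ⟨b.src.shift μ, b.dir⟩ - (2 : ℂ) • chartMatU F K w b + chartMatU F K w ⟨b.src.unshift μ, b.dir⟩)‖ ≤
      gauge (recordDom44J F Mc k K X α₂) w * (α₂ * (F.P K).eta (k + 1) ^ 3) :=
  ((gauge_recordDom44J_le_iff F Mc k K X hα (gauge_nonneg _) w).1 le_rfl).2.2.1 b hb hμ

/-- `‖W_J(b)‖ ≤ gauge D w · α₂` on the bonds of `X`. [cite: Balaban1987RG1, (1.14) p.262 (bookkeeping)] -/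
theorem norm_chartMatJc_le_gauge (Mc k K : ℕ) (X : (recordDomSys F Mc k K).Dom) {α₂ : ℝ} (hα : 0 < α₂) (w : Fin (recordChartDimJ F K) → ℂ)
    {b : PBond (F.P K) 0} (hb : b ∈ domBonds F Mc k K X) :
    ‖chartMatJc F K w b‖ ≤ gauge (recordDom44J F Mc k K X α₂) w * α₂ :=
  ((gauge_recordDom44J_le_iff F Mc k K X hα (gauge_nonneg _) w).1 le_rfl).2.2.2 b hb

/-- Every CUT coordinate is bounded by `α₂ · gauge D w` (`ξ ≤ 1` on the `𝐔`-block). [cite: Balaban1987RG1, (4.4) p.281, (1.14) p.262 (bookkeeping)] -/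
theorem norm_apply_le_gauge (Mc k K : ℕ) (X : (recordDomSys F Mc k K).Dom) {α₂ : ℝ} (hα : 0 < α₂) (w : Fin (recordChartDimJ F K) → ℂ)
    {i : Fin (recordChartDimJ F K)} (hi : i ∈ recordCXJ F Mc k K X) :
    ‖w i‖ ≤ α₂ * gauge (recordDom44J F Mc k K X α₂) w := by
  obtain ⟨⟨b, s⟩, rfl⟩ := (chartEquivJ F K).surjective i
  have hb : b ∈ domBonds F Mc k K X := (chartEquivJ_mem_recordCXJ_iff F Mc k K X b s).1 hi
  have hg := gauge_nonneg (s := recordDom44J F Mc k K X α₂) w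
  rcases s with a | a
  · calc ‖w (chartEquivJ F K (b, Sum.inl a))‖ ≤ ‖chartMatU F K w b‖ := norm_apply_inl_le F K w b a
      _ ≤ gauge (recordDom44J F Mc k K X α₂) w * (α₂ * (F.P K).eta (k + 1)) := norm_chartMatU_le_gauge F Mc k K X hα w hb
      _ ≤ gauge (recordDom44J F Mc k K X α₂) w * (α₂ * 1) := by
          gcongr; exact pow_le_one₀ (inv_nonneg.2 (Nat.cast_nonneg _)) (inv_le_one_of_one_le₀ (Nat.one_le_cast.2 (F.P K).L_pos))
      _ = α₂ * gauge (recordDom44J F Mc k K X α₂) w := by ring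
  · calc ‖w (chartEquivJ F K (b, Sum.inr a))‖ ≤ ‖chartMatJc F K w b‖ := norm_apply_inr_le F K w b a
      _ ≤ gauge (recordDom44J F Mc k K X α₂) w * α₂ := norm_chartMatJc_le_gauge F Mc k K X hα w hb
      _ = α₂ * gauge (recordDom44J F Mc k K X α₂) w := by ring

/-- ★ **THE CUT VECTOR IS BOUNDED BY THE GAUGE**: `‖cutTo (recordCXJ X) w‖ ≤ α₂ · gauge D w` (sup norm of the coordinates on the bonds of `X`).
[cite: Balaban1987RG1, (4.4) p.281, (1.14) p.262 (bookkeeping)] -/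
theorem norm_cutTo_le_gauge (Mc k K : ℕ) (X : (recordDomSys F Mc k K).Dom) {α₂ : ℝ} (hα : 0 < α₂) (w : Fin (recordChartDimJ F K) → ℂ) :
    ‖cutTo (recordCXJ F Mc k K X) w‖ ≤ α₂ * gauge (recordDom44J F Mc k K X α₂) w := by
  refine (pi_norm_le_iff_of_nonneg (mul_nonneg hα.le (gauge_nonneg _))).2 fun i => ?_
  rw [cutTo_apply]
  split_ifs with hi
  · exact norm_apply_le_gauge F Mc k K X hα w hi
  · rw [norm_zero]; exact mul_nonneg hα.le (gauge_nonneg _)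

/-- ★ **THE GAUGE IS DEFINITE ON THE CUT SPACE**: `gauge D (cut vector) = 0 ⟹ cut vector = 0`.  (On the full chart space the gauge is only a
seminorm — the domain does not read the bonds off `X`.) [cite: Balaban1987RG1, (4.4) p.281 (bookkeeping)] -/
theorem cutTo_eq_zero_of_gauge_eq_zero (Mc k K : ℕ) (X : (recordDomSys F Mc k K).Dom) {α₂ : ℝ} (hα : 0 < α₂) (w : Fin (recordChartDimJ F K) → ℂ)
    (h : gauge (recordDom44J F Mc k K X α₂) (cutTo (recordCXJ F Mc k K X) w) = 0) :
    cutTo (recordCXJ F Mc k K X) w = 0 := by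
  have hle := norm_cutTo_le_gauge F Mc k K X hα (cutTo (recordCXJ F Mc k K X) w)
  have hcc : cutTo (recordCXJ F Mc k K X) (cutTo (recordCXJ F Mc k K X) w) = cutTo (recordCXJ F Mc k K X) w := by
    ext i; simp only [cutTo_apply]; split_ifs <;> rfl
  rw [hcc, h, mul_zero] at hle
  exact norm_le_zero_iff.1 hle

/-- ★ **THE CUT DOMAIN IS BOUNDED**: `cutTo (recordCXJ X) '' recordDom44J X α₂ ⊆ ball 0 α₂` (sup norm).
[cite: Balaban1987RG1, (4.4) p.281, (1.14) p.262 (bookkeeping)] -/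
theorem cutTo_image_recordDom44J_subset_ball (Mc k K : ℕ) (X : (recordDomSys F Mc k K).Dom) {α₂ : ℝ} (hα : 0 < α₂) :
    cutTo (recordCXJ F Mc k K X) '' recordDom44J F Mc k K X α₂ ⊆ Metric.ball 0 α₂ := by
  rintro _ ⟨w, hw, rfl⟩
  rw [mem_ball_zero_iff]
  have hg := (mem_recordDom44J_iff_gauge_lt_one F Mc k K X hα w).1 hw
  calc ‖cutTo (recordCXJ F Mc k K X) w‖ ≤ α₂ * gauge (recordDom44J F Mc k K X α₂) w := norm_cutTo_le_gauge F Mc k K X hα w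
    _ < α₂ * 1 := mul_lt_mul_of_pos_left hg hα
    _ = α₂ := mul_one _

/-- The cut domain is von Neumann BOUNDED (the (Φ2) instance clause). [cite: Balaban1987RG1, (4.4) p.281 (bookkeeping)] -/
theorem isVonNBounded_cutTo_image_recordDom44J (Mc k K : ℕ) (X : (recordDomSys F Mc k K).Dom) {α₂ : ℝ} (hα : 0 < α₂) :
    Bornology.IsVonNBounded ℂ (cutTo (recordCXJ F Mc k K X) '' recordDom44J F Mc k K X α₂) :=
  (NormedSpace.isVonNBounded_ball ℂ _ α₂).subset (cutTo_image_recordDom44J_subset_ball F Mc k K X hα)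

/-! ## §5  `cutTo`-TRANSPARENCY: the domain reads only the bonds of `X`, so `gauge D (cutTo (recordCXJ X) u) = gauge D u` -/

/-- On a bond of `X` the cut vector has the same `𝐔`-block. [cite: Balaban1987RG1, (1.7) p.261 (bookkeeping)] -/
theorem chartMatU_cutTo_of_mem (Mc k K : ℕ) (X : (recordDomSys F Mc k K).Dom) (u : Fin (recordChartDimJ F K) → ℂ) {b : PBond (F.P K) 0}
    (hb : b ∈ domBonds F Mc k K X) : chartMatU F K (cutTo (recordCXJ F Mc k K X) u) b = chartMatU F K u b := by
  simp only [chartMatU, cutTo_apply, (chartEquivJ_mem_recordCXJ_iff F Mc k K X b _).2 hb, if_true]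

/-- On a bond of `X` the cut vector has the same `𝐉`-block. [cite: Balaban1987RG1, (1.7) p.261 (bookkeeping)] -/
theorem chartMatJc_cutTo_of_mem (Mc k K : ℕ) (X : (recordDomSys F Mc k K).Dom) (u : Fin (recordChartDimJ F K) → ℂ) {b : PBond (F.P K) 0}
    (hb : b ∈ domBonds F Mc k K X) : chartMatJc F K (cutTo (recordCXJ F Mc k K X) u) b = chartMatJc F K u b := by
  simp only [chartMatJc, cutTo_apply, (chartEquivJ_mem_recordCXJ_iff F Mc k K X b _).2 hb, if_true]

/-- ★ **`cutTo` IS TRANSPARENT TO THE DOMAIN**: `cutTo (recordCXJ X) u ∈ recordDom44J X α₂ ↔ u ∈ recordDom44J X α₂` (every clause reads `chartMatU ∕ chartMatJc`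
at bonds of `X` only). [cite: Balaban1987RG1, (4.4) p.281, (1.7) p.261 (bookkeeping)] -/
theorem cutTo_mem_recordDom44J_iff (Mc k K : ℕ) (X : (recordDomSys F Mc k K).Dom) (α₂ : ℝ) (u : Fin (recordChartDimJ F K) → ℂ) :
    cutTo (recordCXJ F Mc k K X) u ∈ recordDom44J F Mc k K X α₂ ↔ u ∈ recordDom44J F Mc k K X α₂ := by
  have hU := fun b (hb : b ∈ domBonds F Mc k K X) => chartMatU_cutTo_of_mem F Mc k K X u hb
  have hJ := fun b (hb : b ∈ domBonds F Mc k K X) => chartMatJc_cutTo_of_mem F Mc k K X u hb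
  simp only [recordDom44J, Set.mem_setOf_eq]
  refine ⟨fun ⟨h1, h2, h3, h4⟩ => ⟨fun b hb => ?_, fun b hb μ hμ => ?_, fun b hb hμ => ?_, fun b hb => ?_⟩,
    fun ⟨h1, h2, h3, h4⟩ => ⟨fun b hb => ?_, fun b hb μ hμ => ?_, fun b hb hμ => ?_, fun b hb => ?_⟩⟩
  · simpa only [hU b hb] using h1 b hb
  · simpa only [hU b hb, hU _ hμ] using h2 b hb μ hμ
  · have := h3 b hb hμ
    rwa [hU b hb, Finset.sum_congr rfl fun μ _ => by rw [hU _ (hμ μ).1, hU _ (hμ μ).2]] at this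
  · simpa only [hJ b hb] using h4 b hb
  · simpa only [hU b hb] using h1 b hb
  · simpa only [hU b hb, hU _ hμ] using h2 b hb μ hμ
  · rw [hU b hb, Finset.sum_congr rfl fun μ _ => by rw [hU _ (hμ μ).1, hU _ (hμ μ).2]]
    exact h3 b hb hμ
  · simpa only [hJ b hb] using h4 b hb

/-- ★★ **THE GAUGE DOES NOT SEE THE CUT**: `gauge (recordDom44J X α₂) (cutTo (recordCXJ X) u) = gauge (recordDom44J X α₂) u` — `Response9D`'s rows
may drop their `cutTo`. [cite: Balaban1987RG1, (4.4) p.281, (4.35) p.290 (bookkeeping)] -/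
theorem gauge_recordDom44J_cutTo (Mc k K : ℕ) (X : (recordDomSys F Mc k K).Dom) (α₂ : ℝ) (u : Fin (recordChartDimJ F K) → ℂ) :
    gauge (recordDom44J F Mc k K X α₂) (cutTo (recordCXJ F Mc k K X) u) = gauge (recordDom44J F Mc k K X α₂) u := by
  have hlin : ∀ r : ℝ, cutTo (recordCXJ F Mc k K X) (r • u) = r • cutTo (recordCXJ F Mc k K X) u := fun r => by
    ext i; simp only [cutTo_apply, Pi.smul_apply]; split_ifs <;> simp
  have key : ∀ r : ℝ, 0 < r → (cutTo (recordCXJ F Mc k K X) u ∈ r • recordDom44J F Mc k K X α₂ ↔ u ∈ r • recordDom44J F Mc k K X α₂) := by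
    intro r hr
    rw [Set.mem_smul_set_iff_inv_smul_mem₀ hr.ne', Set.mem_smul_set_iff_inv_smul_mem₀ hr.ne', ← hlin, cutTo_mem_recordDom44J_iff]
  rw [gauge_def, gauge_def]
  congr 1
  ext r
  simp only [Set.mem_Ioi]
  exact ⟨fun ⟨hr, h⟩ => ⟨hr, (key r hr).1 h⟩, fun ⟨hr, h⟩ => ⟨hr, (key r hr).2 h⟩⟩

end Summit.QuantumFields.YangMills.Theorems.PortU2

end
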